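import Summits.Ventures.Crystal3D.Theorems.StickyWulffConstantGenericWallFloorFramePropagation
import Summits.Ventures.Crystal3D.Theorems.StickyWulffConstantGenericWallFloorMixedDozenRules
import Literature.MathematicalPhysics.StatisticalMechanics.BarlowBilayers
import HarnessLib

/-!
# The exit lemma of the general-filling ledger: above a full-shell lattice ball, a saturated defect is a twin cap

HONEST FRAMING. Part of the venture `Summits/Ventures/Crystal3D` (cell `crystal3d-full`), helper for the
crux `GenericWallFloor` (stmt-Ventures-19480) of `route-Ventures-StickyWulffConstant`, REGISTERED line
`WallLedgerG` (planner cf-p1 gen 16), stub `stub_twoSlabAdhesion : TwoSlabAdhesion` (THE CRUX of the line).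
The rigid rung is landed; this is the first brick of the GENERAL (non-rigid) filling: the local structure at
the EXITS of the grain domain.  Rung credit only; F-C1 not moved.

SETTING (no cell, no plates, no `ρ`; arbitrary foreign balls).  `X` a finite configuration, `A` a linear
isometry (the grain's frame; slots `A w`, `w ∈ fccSlots`), `d ∈ X` a ball with its FULL shell
`d + A w ∈ X`, `u` a slot and `e = d + A u` the next ball on the `u`-line (along every slot line leaving
the clamped slab the first ball without a full shell is such an `e`).

**Theorem (`exit_twinCap_of_patch`).**  If `e` has twelve contacts, some slot `e + A v` is NOT occupied,
and the balls of `X` within contact distance `2` of `e` lie in one rigid image `(fun p => L p + s) '' B(σ)`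
of a close-packed stacking (the output of `barlowPatch_of_saturated_withinThree`, i.e. of the venture's
radius-2 lemma under GAP/CLASSIFICATION when every ball within contact distance `3` of `e` is
saturated), then `e` is an EXACT TWIN CAP over `d`: there is a unit vector `n` with `⟪A w, n⟫ ∈
{0, ±√(2/3)}` for all slots (a `{111}` layer normal of the grain), `⟪A u, n⟫ = √(2/3)`; the nine slots
with `⟪A w, n⟫ ≤ 0` are occupied; the three with `⟪A w, n⟫ > 0` are EMPTY and their mirror images
`e − A w + 2⟪A w, n⟫ n` are occupied.  (The fcc-type alternative would fill every slot of `e`.)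
Ingredients: shell capture at `d` (`image_const_eq_barlow_const_of_shell`), the site of `e`
(`exists_site_of_unit_constε`), saturation ⇒ every stacking neighbour site of `e` is occupied
(`patch_shell_sites_mem`, via `ncard_touching_eq_twelve`), letter arithmetic of an hcp-type layer
(`not_mem_barlowStacking_of_not_dvd`, from `sq_div_three_le_norm_inPlane_sq`).

WHAT THIS IS NOT: not the stub; nothing about terraces/risers yet; F-C1 not moved.
-/

noncomputable section

namespace Summit.Ventures.Crystal3D.Theorems

open Summit.Ventures.Crystal3D Finset
open Literature.MathematicalPhysics.StatisticalMechanics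
open scoped InnerProductSpace

variable {X : Finset (EuclideanSpace ℝ (Fin 3))}

/-! ### Saturation fills every stacking neighbour site -/

/-- **Occupation.**  If `e = L y + s` has twelve contacts in `X`, all lying in the patch
`(fun p => L p + s) '' B(σ)` (`y ∈ B(σ)`, `σ` Hägg), then EVERY site of `B(σ)` at distance `1` from `y`
carries a ball of `X` (both sets have twelve elements). -/
theorem patch_shell_sites_mem {σ : ℤ → ℤ} (hσ : IsHaggSeq σ)
    (L : EuclideanSpace ℝ (Fin 3) ≃ₗᵢ[ℝ] EuclideanSpace ℝ (Fin 3)) (s : EuclideanSpace ℝ (Fin 3))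
    {e y : EuclideanSpace ℝ (Fin 3)} (hey : e = L y + s)
    (hy : y ∈ barlowStacking 1 (Real.sqrt (2 / 3)) σ)
    (h12 : (X.filter fun q => dist e q = 1).card = 12)
    (hnb : ∀ q ∈ X, dist e q = 1 → L.symm (q - s) ∈ barlowStacking 1 (Real.sqrt (2 / 3)) σ)
    {q' : EuclideanSpace ℝ (Fin 3)} (hq' : q' ∈ barlowStacking 1 (Real.sqrt (2 / 3)) σ)
    (hd : dist y q' = 1) : L q' + s ∈ X := by
  classical
  set T : Set (EuclideanSpace ℝ (Fin 3)) :=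
    {q | q ∈ barlowStacking 1 (Real.sqrt (2 / 3)) σ ∧ dist y q = 1} with hT
  have hTcard : T.ncard = 12 := ncard_touching_eq_twelve hσ one_pos sqrt_twoThirds_sq hy
  have hTfin : T.Finite := Set.finite_of_ncard_ne_zero (by rw [hTcard]; norm_num)
  set N : Set (EuclideanSpace ℝ (Fin 3)) := {q | q ∈ X ∧ dist e q = 1} with hN
  have hNcard : N.ncard = 12 := by
    have : N = ((X.filter fun q => dist e q = 1 : Finset _) : Set _) := by ext q; simp [hN]
    rw [this, Set.ncard_coe_finset, h12]
  set φ : EuclideanSpace ℝ (Fin 3) → EuclideanSpace ℝ (Fin 3) := fun q => L.symm (q - s) with hφ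
  have hφinj : Function.Injective φ := fun a b h => sub_left_injective (L.symm.injective h)
  have hdist : ∀ q, dist y (φ q) = dist e q := by
    intro q
    have : q = L (φ q) + s := by simp [hφ]
    rw [hey, this, dist_add_right, LinearIsometryEquiv.dist_map]
    simp [hφ]
  have hIT : φ '' N ⊆ T := by
    rintro _ ⟨q, ⟨hq, hdq⟩, rfl⟩
    exact ⟨hnb q hq hdq, by rw [hdist, hdq]⟩
  have hIeqT : φ '' N = T :=
    Set.eq_of_subset_of_ncard_le hIT (by rw [hTcard, Set.ncard_image_of_injective _ hφinj, hNcard]) hTfin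
  have : q' ∈ φ '' N := by rw [hIeqT]; exact ⟨hq', hd⟩
  obtain ⟨q, ⟨hq, -⟩, hφq⟩ := this
  have : L q' + s = q := by rw [← hφq]; simp [hφ]
  rw [this]; exact hq

/-! ### Letter arithmetic: a point over the wrong hollow class is not a site -/

/-- `layerNormal H = H • e₃`. -/
theorem layerNormal_eq_smul_single (H : ℝ) :
    layerNormal H = H • EuclideanSpace.single (2 : Fin 3) (1 : ℝ) := by
  ext t
  fin_cases t <;> simp [layerNormal]

/-- The third coordinate of an in-plane-plus-height combination. -/
theorem combo_apply_two (H : ℝ) (P Q Λ' m : ℝ) :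
    (P • triangularVec₁ (1 : ℝ) + Q • triangularVec₂ (1 : ℝ) + Λ' • barlowOffset (1 : ℝ) +
      m • layerNormal H) 2 = m * H := by
  simp [triangularVec₁, triangularVec₂, barlowOffset, layerNormal]

/-- A point at height `m·h` whose letter differs (mod `3`) from that of layer `m` is not a site of the
stacking. -/
theorem not_mem_barlowStacking_of_not_dvd (σ : ℤ → ℤ) (P Q Λ' m : ℤ)
    (hΛ : ¬ (3 : ℤ) ∣ Λ' - haggLabel σ m) :
    (P : ℝ) • triangularVec₁ (1 : ℝ) + (Q : ℝ) • triangularVec₂ (1 : ℝ) + (Λ' : ℝ) • barlowOffset (1 : ℝ) +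
        (m : ℝ) • layerNormal (Real.sqrt (2 / 3)) ∉ barlowStacking 1 (Real.sqrt (2 / 3)) σ := by
  rintro ⟨k, i, j, hk⟩
  -- heights: `k = m`
  have hs : Real.sqrt (2 / 3) ≠ 0 := by positivity
  have hkm : k = m := by
    have h2 := congrArg (fun x : EuclideanSpace ℝ (Fin 3) => x 2) hk
    simp only [combo_apply_two, barlowPos_apply_two] at h2
    have : (m : ℝ) = k := mul_right_cancel₀ hs h2
    exact_mod_cast this.symm
  subst hkm
  -- the in-plane difference has a letter not divisible by three, hence is nonzero
  have hvec : ((P - i : ℤ) : ℝ) • triangularVec₁ (1 : ℝ) + ((Q - j : ℤ) : ℝ) • triangularVec₂ (1 : ℝ) +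
      ((Λ' - haggLabel σ k : ℤ) : ℝ) • barlowOffset (1 : ℝ) = 0 := by
    rw [barlowPos] at hk
    push_cast
    have hk' := sub_eq_zero.2 hk
    rw [← hk']
    module
  have hle := sq_div_three_le_norm_inPlane_sq (1 : ℝ) (P := P - i) (Q := Q - j) hΛ
  rw [hvec, norm_zero] at hle
  norm_num at hle

/-- The site form of an in-plane-plus-height vector. -/
theorem barlowPos_eq_combo (σ : ℤ → ℤ) (m i j : ℤ) :
    barlowPos 1 (Real.sqrt (2 / 3)) σ m i j =
      (i : ℝ) • triangularVec₁ (1 : ℝ) + (j : ℝ) • triangularVec₂ (1 : ℝ) +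
        (haggLabel σ m : ℝ) • barlowOffset (1 : ℝ) + (m : ℝ) • layerNormal (Real.sqrt (2 / 3)) := rfl

/-- A combination whose letter is congruent to that of layer `m` IS a site. -/
theorem combo_mem_barlowStacking (σ : ℤ → ℤ) (P Q Λ' m q : ℤ) (hq : Λ' = haggLabel σ m + 3 * q) :
    (P : ℝ) • triangularVec₁ (1 : ℝ) + (Q : ℝ) • triangularVec₂ (1 : ℝ) + (Λ' : ℝ) • barlowOffset (1 : ℝ) +
        (m : ℝ) • layerNormal (Real.sqrt (2 / 3)) ∈ barlowStacking 1 (Real.sqrt (2 / 3)) σ := by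
  refine ⟨m, P + q, Q + q, ?_⟩
  rw [barlowPos_eq_combo, hq]
  have hw : barlowOffset (1 : ℝ) = (1 / 3 : ℝ) • (triangularVec₁ 1 + triangularVec₂ 1) := by
    rw [← three_smul_barlowOffset, smul_smul]; norm_num
  rw [hw]; push_cast; module

/-- A unit vector of the constant stacking `B(ε)` in combination form: `I u + J v + K ε w + K h e₃`,
`K ∈ {0, ±1}`, height `K h`. -/
theorem exists_combo_of_unit_constε {ε : ℤ} (hε : ε = 1 ∨ ε = -1) {p : EuclideanSpace ℝ (Fin 3)}
    (hp : p ∈ barlowStacking 1 (Real.sqrt (2 / 3)) (fun _ : ℤ => ε)) (hp1 : ‖p‖ = 1) :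
    ∃ K I J : ℤ, (K = 0 ∨ K = 1 ∨ K = -1) ∧
      p = (I : ℝ) • triangularVec₁ (1 : ℝ) + (J : ℝ) • triangularVec₂ (1 : ℝ) +
        ((K * ε : ℤ) : ℝ) • barlowOffset (1 : ℝ) + (K : ℝ) • layerNormal (Real.sqrt (2 / 3)) ∧
      p 2 = K * Real.sqrt (2 / 3) := by
  obtain ⟨K, I, J, rfl, hK⟩ := exists_site_of_unit_constε hε hp hp1
  refine ⟨K, I, J, hK, ?_, by rw [barlowPos_apply_two]⟩
  rw [barlowPos_eq_combo, haggLabel_constε]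

/-- Letters one and two layers away from an fcc-type layer `k` (`σ(k−1) = σ k = ε`), in the direction
`K = ±1`: `L_{k+K} = L_k + K ε` and `L_{k+2K} = L_{k+K} + τ` for a sign `τ`. -/
theorem haggLabel_steps {σ : ℤ → ℤ} (hσ : IsHaggSeq σ) {k ε K : ℤ} (hk : σ k = ε) (hk' : σ (k - 1) = ε)
    (hK : K = 1 ∨ K = -1) :
    haggLabel σ (k + K) = haggLabel σ k + K * ε ∧
      ∃ τ : ℤ, (τ = 1 ∨ τ = -1) ∧ haggLabel σ (k + 2 * K) = haggLabel σ (k + K) + τ := by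
  rcases hK with rfl | rfl
  · refine ⟨by rw [haggLabel_succ, hk, one_mul], σ (k + 1), hσ (k + 1), ?_⟩
    rw [show k + 2 * (1 : ℤ) = k + 1 + 1 by ring, haggLabel_succ]
  · have h1 := haggLabel_sub_haggLabel_pred σ k
    have h2 := haggLabel_sub_haggLabel_pred σ (k - 1)
    rw [hk'] at h1
    refine ⟨by rw [← sub_eq_add_neg]; linarith, -σ (k - 1 - 1), ?_, ?_⟩
    · rcases hσ (k - 1 - 1) with h | h <;> simp [h]
    · rw [show k + 2 * (-1 : ℤ) = k - 1 - 1 by ring, show k + (-1 : ℤ) = k - 1 by ring]; linarith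

/-! ### The exit lemma -/

/-- **Exit lemma (twin cap), patch form.**  See the module docstring. -/
theorem exit_twinCap_of_patch
    (A : EuclideanSpace ℝ (Fin 3) ≃ₗᵢ[ℝ] EuclideanSpace ℝ (Fin 3)) {d : EuclideanSpace ℝ (Fin 3)}
    (hd : d ∈ X) (hfull : ∀ w ∈ fccSlots, d + A w ∈ X) {u : EuclideanSpace ℝ (Fin 3)} (hu : u ∈ fccSlots)
    (h12 : (X.filter fun q => dist (d + A u) q = 1).card = 12)
    (hv : ∃ v ∈ fccSlots, d + A u + A v ∉ X)
    {σ : ℤ → ℤ} (hσ : IsHaggSeq σ)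
    (L : EuclideanSpace ℝ (Fin 3) ≃ₗᵢ[ℝ] EuclideanSpace ℝ (Fin 3)) (s : EuclideanSpace ℝ (Fin 3))
    (hpatch : ∀ y ∈ X, (y = d + A u ∨ dist (d + A u) y = 1 ∨ ∃ z ∈ X, dist (d + A u) z = 1 ∧ dist z y = 1) →
      y ∈ (fun p => L p + s) '' barlowStacking 1 (Real.sqrt (2 / 3)) σ) :
    ∃ n : EuclideanSpace ℝ (Fin 3), ‖n‖ = 1 ∧
      (∀ w ∈ fccSlots, ⟪A w, n⟫_ℝ = 0 ∨ ⟪A w, n⟫_ℝ = Real.sqrt (2 / 3) ∨ ⟪A w, n⟫_ℝ = -Real.sqrt (2 / 3)) ∧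
      ⟪A u, n⟫_ℝ = Real.sqrt (2 / 3) ∧
      (∀ w ∈ fccSlots, ⟪A w, n⟫_ℝ ≤ 0 → d + A u + A w ∈ X) ∧
      (∀ w ∈ fccSlots, 0 < ⟪A w, n⟫_ℝ →
        d + A u + A w ∉ X ∧ d + A u - A w + (2 * ⟪A w, n⟫_ℝ) • n ∈ X) := by
  classical
  set e : EuclideanSpace ℝ (Fin 3) := d + A u with he
  set H : ℝ := Real.sqrt (2 / 3) with hH
  have hHpos : 0 < H := by positivity
  have hH2 : H ^ 2 = 2 / 3 := Real.sq_sqrt (by norm_num)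
  set e₃ : EuclideanSpace ℝ (Fin 3) := EuclideanSpace.single (2 : Fin 3) (1 : ℝ) with he₃
  have he₃n : ‖e₃‖ = 1 := by rw [he₃, PiLp.norm_single, norm_one]
  have inner_e₃ : ∀ p : EuclideanSpace ℝ (Fin 3), ⟪p, e₃⟫_ℝ = p 2 := by
    intro p; rw [he₃, EuclideanSpace.inner_single_right]; simp
  have hLN : layerNormal H = H • e₃ := layerNormal_eq_smul_single H
  set M : EuclideanSpace ℝ (Fin 3) ≃ₗᵢ[ℝ] EuclideanSpace ℝ (Fin 3) := A.trans L.symm with hM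
  have hMw : ∀ w, M w = L.symm (A w) := fun w => rfl
  have hLM : ∀ w, L (M w) = A w := fun w => by rw [hMw, LinearIsometryEquiv.apply_symm_apply]
  have hunit : ‖A u‖ = 1 := by rw [LinearIsometryEquiv.norm_map, norm_eq_one_of_mem_fccSlots hu]
  have hde : dist e d = 1 := by rw [he, dist_comm, dist_self_add_right, hunit]
  have pull : ∀ y, y ∈ (fun p => L p + s) '' barlowStacking 1 H σ →
      L.symm (y - s) ∈ barlowStacking 1 H σ := by
    rintro y ⟨p, hp, rfl⟩
    simpa using hp
  obtain ⟨k, i, j, hkij⟩ := pull d (hpatch d hd (Or.inr (Or.inl hde)))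
  have hd_eq : d = L (barlowPos 1 H σ k i j) + s := by rw [← hkij]; simp
  have hshell : ∀ w ∈ barlowStacking 1 H (fun _ : ℤ => (1 : ℤ)), ‖w‖ = 1 →
      barlowPos 1 H σ k i j + M w ∈ barlowStacking 1 H σ := by
    intro w hw hw1
    have hws : w ∈ fccSlots := mem_fccSlots_of_unit hw hw1
    have hmem := hpatch (d + A w) (hfull w hws) (Or.inr (Or.inr ⟨d, hd, hde, by
      rw [dist_self_add_right, LinearIsometryEquiv.norm_map, hw1]⟩))
    have h' := pull _ hmem
    have : L.symm (d + A w - s) = barlowPos 1 H σ k i j + M w := by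
      rw [hd_eq, show L (barlowPos 1 H σ k i j) + s + A w - s = L (barlowPos 1 H σ k i j) + A w by abel,
        map_add, LinearIsometryEquiv.symm_apply_apply, ← hMw]
    rwa [this] at h'
  -- shell capture at `d`: fcc-type site, `M·Λ₀ = B(σ k)`
  obtain ⟨hfccd, hMΛ⟩ := image_const_eq_barlow_const_of_shell hσ (Or.inl rfl) M k i j hshell
  set ε : ℤ := σ k with hεdef
  have hε : ε = 1 ∨ ε = -1 := hσ k
  have hMunit : ∀ w ∈ fccSlots, M w ∈ barlowStacking 1 H (fun _ : ℤ => ε) ∧ ‖M w‖ = 1 := fun w hw =>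
    ⟨by rw [← hMΛ]; exact ⟨w, mem_fcc_of_mem_fccSlots hw, rfl⟩,
      by rw [LinearIsometryEquiv.norm_map, norm_eq_one_of_mem_fccSlots hw]⟩
  have slot : ∀ w ∈ fccSlots, ∃ K' I' J' : ℤ, (K' = 0 ∨ K' = 1 ∨ K' = -1) ∧
      M w = (I' : ℝ) • triangularVec₁ (1 : ℝ) + (J' : ℝ) • triangularVec₂ (1 : ℝ) +
        ((K' * ε : ℤ) : ℝ) • barlowOffset (1 : ℝ) + (K' : ℝ) • layerNormal H ∧ (M w) 2 = K' * H :=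
    fun w hw => exists_combo_of_unit_constε hε (hMunit w hw).1 (hMunit w hw).2
  -- the site of `e`
  obtain ⟨K, I, J, hK, hMu, hMu2⟩ := slot u hu
  set ye : EuclideanSpace ℝ (Fin 3) := barlowPos 1 H σ k i j + M u with hye
  have he_eq : e = L ye + s := by rw [he, hye, map_add, hLM, hd_eq]; abel
  have hcombo_e : ye = ((i + I : ℤ) : ℝ) • triangularVec₁ (1 : ℝ) + ((j + J : ℤ) : ℝ) • triangularVec₂ (1 : ℝ) +
      ((haggLabel σ k + K * ε : ℤ) : ℝ) • barlowOffset (1 : ℝ) + ((k + K : ℤ) : ℝ) • layerNormal H := by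
    rw [hye, barlowPos_eq_combo, hMu]; push_cast; module
  have hnbP : ∀ q ∈ X, dist e q = 1 → L.symm (q - s) ∈ barlowStacking 1 H σ :=
    fun q hq hdq => pull q (hpatch q hq (Or.inr (Or.inl hdq)))
  have heX : e ∈ X := by rw [he]; exact hfull u hu
  have hyeP : ye ∈ barlowStacking 1 H σ := by
    have := pull e (hpatch e heX (Or.inl rfl))
    rwa [he_eq, show L ye + s - s = L ye by abel, LinearIsometryEquiv.symm_apply_apply] at this
  have occ : ∀ q' ∈ barlowStacking 1 H σ, dist ye q' = 1 → L q' + s ∈ X :=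
    fun q' hq' hdq' => patch_shell_sites_mem hσ L s he_eq hyeP h12 hnbP hq' hdq'
  have occ_slot : ∀ w ∈ fccSlots, ye + M w ∈ barlowStacking 1 H σ → e + A w ∈ X := by
    intro w hw hmem
    have h := occ (ye + M w) hmem (by rw [dist_self_add_right, (hMunit w hw).2])
    have : L (ye + M w) + s = e + A w := by rw [map_add, hLM, he_eq]; abel
    rwa [this] at h
  have site : ∀ {w} (hw : w ∈ fccSlots) {K' I' J' : ℤ},
      M w = (I' : ℝ) • triangularVec₁ (1 : ℝ) + (J' : ℝ) • triangularVec₂ (1 : ℝ) +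
        ((K' * ε : ℤ) : ℝ) • barlowOffset (1 : ℝ) + (K' : ℝ) • layerNormal H →
      ye + M w = ((i + I + I' : ℤ) : ℝ) • triangularVec₁ (1 : ℝ) + ((j + J + J' : ℤ) : ℝ) • triangularVec₂ (1 : ℝ) +
        ((haggLabel σ k + (K + K') * ε : ℤ) : ℝ) • barlowOffset (1 : ℝ) + ((k + K + K' : ℤ) : ℝ) • layerNormal H := by
    intro w _ K' I' J' hMw'
    rw [hcombo_e, hMw']; push_cast; module
  -- if EVERY slot site were a stacking site, every slot would be occupied: contradiction
  have fill : (∀ w ∈ fccSlots, ye + M w ∈ barlowStacking 1 H σ) → False := fun hall => by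
    obtain ⟨v, hv, hvX⟩ := hv; exact hvX (occ_slot v hv (hall v hv))
  -- `K ≠ 0`: in the layer of `d` the site `ye` is fcc-type with the same frame
  have hKne : K ≠ 0 := by
    rintro rfl
    apply fill
    intro w hw
    obtain ⟨K', I', J', hK', hMw', -⟩ := slot w hw
    rw [site hw hMw']
    have hlet : haggLabel σ k + (0 + K') * ε = haggLabel σ (k + 0 + K') + 3 * 0 := by
      rcases hK' with rfl | rfl | rfl
      · simp
      · rw [show k + 0 + (1 : ℤ) = k + 1 by ring, haggLabel_succ, ← hεdef]; ring
      · have h1 := haggLabel_sub_haggLabel_pred σ k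
        rw [hfccd] at h1
        rw [show k + 0 + (-1 : ℤ) = k - 1 by ring]; linarith
    exact combo_mem_barlowStacking σ _ _ _ _ 0 hlet
  have hKpm : K = 1 ∨ K = -1 := by
    rcases hK with h | h | h <;> [exact absurd h hKne; exact Or.inl h; exact Or.inr h]
  have hKsq : (K : ℝ) * K = 1 := by rcases hKpm with rfl | rfl <;> norm_num
  obtain ⟨hL1, τ, hτ, hL2⟩ := haggLabel_steps hσ hεdef.symm hfccd hKpm
  -- a slot has `K' ∈ {0, K, −K}`
  have slotK : ∀ w ∈ fccSlots, ∃ K' I' J' : ℤ, (K' = 0 ∨ K' = K ∨ K' = -K) ∧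
      M w = (I' : ℝ) • triangularVec₁ (1 : ℝ) + (J' : ℝ) • triangularVec₂ (1 : ℝ) +
        ((K' * ε : ℤ) : ℝ) • barlowOffset (1 : ℝ) + (K' : ℝ) • layerNormal H ∧ (M w) 2 = K' * H := by
    intro w hw
    obtain ⟨K', I', J', hK', h1, h2⟩ := slot w hw
    exact ⟨K', I', J', by rcases hKpm with rfl | rfl <;> rcases hK' with rfl | rfl | rfl <;> simp, h1, h2⟩
  -- in-plane (`K' = 0`) and near (`K' = −K`) slot sites ARE stacking sites
  have near_mem : ∀ {w} (hw : w ∈ fccSlots) {K' I' J' : ℤ}, (K' = 0 ∨ K' = -K) →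
      M w = (I' : ℝ) • triangularVec₁ (1 : ℝ) + (J' : ℝ) • triangularVec₂ (1 : ℝ) +
        ((K' * ε : ℤ) : ℝ) • barlowOffset (1 : ℝ) + (K' : ℝ) • layerNormal H →
      ye + M w ∈ barlowStacking 1 H σ := by
    intro w hw K' I' J' hK' hMw'
    rw [site hw hMw']
    refine combo_mem_barlowStacking σ _ _ _ _ 0 ?_
    rcases hK' with rfl | rfl
    · rw [show k + K + 0 = k + K by ring, hL1]; ring
    · rw [show k + K + -K = k by ring]; ring
  -- the twin is NOT the fcc continuation: `τ = −K ε`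
  have hτε : τ = -(K * ε) := by
    by_contra hne
    have hτe : τ = K * ε := by
      rcases hτ with rfl | rfl <;> rcases hKpm with rfl | rfl <;> rcases hε with h | h <;>
        simp only [h] at hne ⊢ <;> omega
    apply fill
    intro w hw
    obtain ⟨K', I', J', hK', hMw', -⟩ := slotK w hw
    rcases hK' with hK' | hK' | hK'
    · exact near_mem hw (Or.inl hK') hMw'
    · subst hK'
      rw [site hw hMw']
      refine combo_mem_barlowStacking σ _ _ _ _ 0 ?_
      rw [show k + K' + K' = k + 2 * K' by ring, hL2, hL1, hτe]; ring
    · exact near_mem hw (Or.inr hK') hMw'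
  -- the normal
  set n : EuclideanSpace ℝ (Fin 3) := (K : ℝ) • L e₃ with hn
  have hAn : ∀ w, ⟪A w, n⟫_ℝ = K * (M w) 2 := by
    intro w
    rw [hn, inner_smul_right, ← hLM w, LinearIsometryEquiv.inner_map_map, inner_e₃]
  refine ⟨n, ?_, ?_, ?_, ?_, ?_⟩
  · rw [hn, norm_smul, LinearIsometryEquiv.norm_map, he₃n, mul_one]
    rcases hKpm with rfl | rfl <;> norm_num
  · intro w hw
    obtain ⟨K', I', J', hK', -, h2⟩ := slotK w hw
    rw [hAn, h2, ← mul_assoc]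
    rcases hK' with rfl | rfl | rfl
    · left; ring
    · right; left; rw [hKsq, one_mul]
    · right; right
      rw [show (K : ℝ) * ((-K : ℤ) : ℝ) = -((K : ℝ) * K) by push_cast; ring, hKsq]; ring
  · rw [hAn, hMu2, ← mul_assoc, hKsq, one_mul]
  · -- near and in-plane slots are occupied
    intro w hw hle
    obtain ⟨K', I', J', hK', hMw', h2⟩ := slotK w hw
    have hK'le : K' = 0 ∨ K' = -K := by
      rcases hK' with h | rfl | h
      · exact Or.inl h
      · exfalso
        rw [hAn, h2, ← mul_assoc, hKsq, one_mul] at hle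
        linarith
      · exact Or.inr h
    exact occ_slot w hw (near_mem hw hK'le hMw')
  · -- far slots: empty, mirror occupied
    intro w hw hlt
    obtain ⟨K', I', J', hK', hMw', h2⟩ := slotK w hw
    have hK'K : K' = K := by
      rcases hK' with rfl | h | rfl
      · simp [hAn, h2] at hlt
      · exact h
      · exfalso
        rw [hAn, h2, ← mul_assoc, show (K : ℝ) * ((-K : ℤ) : ℝ) = -((K : ℝ) * K) by push_cast; ring,
          hKsq] at hlt
        linarith
    subst hK'K
    have hAwn : ⟪A w, n⟫_ℝ = H := by rw [hAn, h2, ← mul_assoc, hKsq, one_mul]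
    constructor
    · -- `e + A w ∉ X`: its pull-back sits over the wrong letter
      intro hX'
      have hP := hnbP (e + A w) hX' (by rw [dist_self_add_right, LinearIsometryEquiv.norm_map,
        norm_eq_one_of_mem_fccSlots hw])
      have : L.symm (e + A w - s) = ye + M w := by
        rw [he_eq, show L ye + s + A w - s = L ye + A w by abel, map_add,
          LinearIsometryEquiv.symm_apply_apply, ← hMw]
      rw [this, site hw hMw'] at hP
      refine not_mem_barlowStacking_of_not_dvd σ (i + I + I') (j + J + J')
        (haggLabel σ k + (K' + K') * ε) (k + K' + K') ?_ hP
      rw [show k + K' + K' = k + 2 * K' by ring, hL2, hL1, hτε]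
      rcases hKpm with rfl | rfl <;> rcases hε with h | h <;> simp only [h] <;> omega
    · -- the mirror site `ye + c`, `c = −M w + 2 K' H e₃`, is a stacking neighbour of `ye`
      set c : EuclideanSpace ℝ (Fin 3) := -(M w) + (2 * K' * H) • e₃ with hc
      have hc_combo : c = ((-I' : ℤ) : ℝ) • triangularVec₁ (1 : ℝ) + ((-J' : ℤ) : ℝ) • triangularVec₂ (1 : ℝ) +
          ((-(K' * ε) : ℤ) : ℝ) • barlowOffset (1 : ℝ) + (K' : ℝ) • layerNormal H := by
        rw [hc, hMw', hLN]; push_cast; module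
      have hsite : ye + c ∈ barlowStacking 1 H σ := by
        have : ye + c = ((i + I - I' : ℤ) : ℝ) • triangularVec₁ (1 : ℝ) + ((j + J - J' : ℤ) : ℝ) • triangularVec₂ (1 : ℝ) +
            ((haggLabel σ k : ℤ) : ℝ) • barlowOffset (1 : ℝ) + ((k + 2 * K' : ℤ) : ℝ) • layerNormal H := by
          rw [hcombo_e, hc_combo]; push_cast; module
        rw [this]
        refine combo_mem_barlowStacking σ _ _ _ _ 0 ?_
        rw [hL2, hL1, hτε]; ring
      have hcnorm : ‖c‖ = 1 := by
        have hMw1 : ‖M w‖ = 1 := (hMunit w hw).2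
        have hcn2 : ‖c‖ ^ 2 = 1 := by
          rw [hc, norm_add_sq_real, norm_neg, hMw1, inner_neg_left, inner_smul_right, inner_e₃, h2,
            norm_smul, he₃n, mul_one, Real.norm_eq_abs, sq_abs]
          have hK2 : (K' : ℝ) ^ 2 = 1 := by rw [sq, hKsq]
          nlinarith [hH2, hK2]
        rw [← abs_of_nonneg (norm_nonneg c), ← Real.sqrt_sq_eq_abs, hcn2, Real.sqrt_one]
      have hmem := occ (ye + c) hsite (by rw [dist_self_add_right, hcnorm])
      have hLc : L c = -(A w) + (2 * K' * H) • L e₃ := by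
        rw [hc, map_add, map_neg, hLM, map_smul]
      have : L (ye + c) + s = e - A w + (2 * ⟪A w, n⟫_ℝ) • n := by
        rw [map_add, hLc, he_eq, hAwn, hn, smul_smul, mul_right_comm]
        abel
      rw [← this]; exact hmem

end Summit.Ventures.Crystal3D.Theorems

end
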